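import Mathlib.NumberTheory.LegendreSymbol.JacobiSymbol
import Mathlib.Tactic.NormNum.LegendreSymbol
import Mathlib.Algebra.Ring.Periodic
import Mathlib.Data.Complex.Basic
import HarnessLib

set_option autoImplicit false

/-!
# Crux `PrintCFram.BottomClassIndexLawFiveLe` (stmt-BirchSwinnertonDyer-20372), line `eisenstein-resource-bdp-line` (registry v24):
# LEMMA D OF THE CUSP SEED, LOCAL PART — Chinese-remainder splitting of a period mean and the local Jacobi-symbol means
# (cell `bsd-print-cfram`, width seat `bsd-line-cfram-p1-w3` g13; THEOREMS ONLY, `--supports` 20372; Mathlib currency;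
# BSD is not proved by any of this)

HONEST FRAMING. Elementary finite sums (no elliptic curve, no BSD): the local half of ingredient (D) «family mean values»
(crux notes `Lines/eisenstein-resource-bdp-line-w5g5-cusp-seed.md` §4 (ii)) for the cusp conjunct of
`CuspSeed.cuspSeed_six_of_cutForm`. The analytic half (`…CuspSeedSquarefreeDensity`: the Dirichlet density of a
squarefree-supported periodic weight is `L(𝟙·μ, 2) · (1/Q) Σ_{j<Q} w(j)`) leaves a MEAN OVER ONE PERIOD to evaluate; for the
family of the cusp seed the weight is a product of a mod-`8` factor and one factor per odd prime `ℓ ∣ 3mn`, each periodic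
mod `ℓ`. This file proves:

* `sum_range_mul_eq_of_coprime`: `Σ_{j < ab} u(j)v(j) = (Σ_{j<a} u)(Σ_{j<b} v)` for `u` `a`-periodic, `v` `b`-periodic, `(a,b) = 1`
  (Chinese remainder theorem, Mathlib `Nat.chineseRemainder`);
* `sum_range_mul_prod_eq`: its iterate over a finite set `S` of odd primes against a mod-`8` factor:
  `Σ_{j < 8·∏S} u(j)·∏_{ℓ∈S} λ_ℓ(j) = (Σ_{j<8} u)·∏_{ℓ∈S} Σ_{j<ℓ} λ_ℓ`;
* the local means: `Σ_{j<ℓ} (j/ℓ) = 0`, `Σ_{j<ℓ} (j/ℓ)² = ℓ − 1`, hence `Σ_{j<ℓ} (j/ℓ)^v = [v even](ℓ − 1)` (`v ≥ 1`) and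
  `#{j < q : (−j/q) = +1} = (q − 1)/2` (`ℓ, q` odd primes; Legendre symbols as Mathlib Jacobi symbols `J(· | ·)`);
* the two small blocks of the cusp-seed family: mod `8` (`N ≡ 3 (4)` [`≡ 7 (8)`] weighted by `(2/N)^v`) and mod `3`
  (`3 ∤ N` [`(−N/3) = 1`] weighted by `(N/3)^v`).

Standard. [folklore]

References: Mathlib `Mathlib.NumberTheory.LegendreSymbol.JacobiSymbol`, `Mathlib.Data.Nat.ModEq` (`Nat.chineseRemainder`),
`quadraticChar_sum_zero`.
-/

-- summit-side namespace `Summit.BirchSwinnertonDyer.BirchSwinnertonDyer.…` (single-conjunct summit, D-0017 layout)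
set_option linter.dupNamespace false

namespace Summit.BirchSwinnertonDyer.BirchSwinnertonDyer.Theorems.PrintCFram.FamilyMean

open Finset
open scoped NumberTheorySymbols

/-! ### §1. Chinese remainder: the mean of a product of periodic factors with coprime periods -/

/-- **CRT splitting of a period sum.** For coprime `a, b ≥ 1`, `u` periodic mod `a` and `v` periodic mod `b`:
`Σ_{j < ab} u(j) v(j) = (Σ_{j < a} u(j)) · (Σ_{j < b} v(j))` (`j ↦ (j mod a, j mod b)` is a bijection
`[0, ab) → [0, a) × [0, b)`, Mathlib `Nat.chineseRemainder`). [folklore] -/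
theorem sum_range_mul_eq_of_coprime {a b : ℕ} (hab : a.Coprime b) (ha : a ≠ 0) (hb : b ≠ 0)
    {u v : ℕ → ℂ} (hu : Function.Periodic u a) (hv : Function.Periodic v b) :
    ∑ j ∈ range (a * b), u j * v j = (∑ j ∈ range a, u j) * ∑ j ∈ range b, v j := by
  rw [Finset.sum_mul_sum, ← Finset.sum_product']
  refine Finset.sum_nbij' (fun j ↦ (j % a, j % b))
    (fun p ↦ (Nat.chineseRemainder hab p.1 p.2 : ℕ)) ?_ ?_ ?_ ?_ ?_
  · intro j _
    simp only [mem_product, mem_range]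
    exact ⟨Nat.mod_lt _ (Nat.pos_of_ne_zero ha), Nat.mod_lt _ (Nat.pos_of_ne_zero hb)⟩
  · intro p _
    simp only [mem_range]
    exact Nat.chineseRemainder_lt_mul hab p.1 p.2 ha hb
  · intro j hj
    simp only [mem_range] at hj
    have h := Nat.chineseRemainder_modEq_unique hab (a := j % a) (b := j % b) (z := j)
      (Nat.mod_modEq j a).symm (Nat.mod_modEq j b).symm
    exact (Nat.ModEq.eq_of_lt_of_lt h hj (Nat.chineseRemainder_lt_mul hab _ _ ha hb)).symm
  · intro p hp
    simp only [mem_product, mem_range] at hp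
    have h1 : (Nat.chineseRemainder hab p.1 p.2 : ℕ) % a = p.1 % a :=
      (Nat.chineseRemainder hab p.1 p.2).2.1
    have h2 : (Nat.chineseRemainder hab p.1 p.2 : ℕ) % b = p.2 % b :=
      (Nat.chineseRemainder hab p.1 p.2).2.2
    ext
    · exact h1.trans (Nat.mod_eq_of_lt hp.1)
    · exact h2.trans (Nat.mod_eq_of_lt hp.2)
  · intro j _
    dsimp only
    rw [hu.map_mod_nat, hv.map_mod_nat]

/-- A function periodic mod `c` is periodic mod any multiple `d` of `c`. [folklore] -/
theorem periodic_of_dvd {u : ℕ → ℂ} {c d : ℕ} (hu : Function.Periodic u c) (hcd : c ∣ d) :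
    Function.Periodic u d := by
  obtain ⟨e, rfl⟩ := hcd
  rw [mul_comm]
  exact hu.nat_mul e

/-- **Iterated CRT splitting.** For a finite set `S` of odd primes, `u` periodic mod `8` and `λ_ℓ` periodic mod `ℓ`
(`ℓ ∈ S`): `Σ_{j < 8·∏_{ℓ∈S} ℓ} u(j) · ∏_{ℓ∈S} λ_ℓ(j) = (Σ_{j<8} u(j)) · ∏_{ℓ∈S} Σ_{j<ℓ} λ_ℓ(j)`. [folklore] -/
theorem sum_range_mul_prod_eq (S : Finset ℕ) (hS : ∀ ℓ ∈ S, ℓ.Prime ∧ ℓ ≠ 2)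
    (u : ℕ → ℂ) (hu : Function.Periodic u 8) (lam : ℕ → ℕ → ℂ)
    (hlam : ∀ ℓ ∈ S, Function.Periodic (lam ℓ) ℓ) :
    ∑ j ∈ range (8 * ∏ ℓ ∈ S, ℓ), u j * ∏ ℓ ∈ S, lam ℓ j =
      (∑ j ∈ range 8, u j) * ∏ ℓ ∈ S, ∑ j ∈ range ℓ, lam ℓ j := by
  induction S using Finset.induction_on with
  | empty => simp
  | insert a s has ih =>
    have hS' : ∀ ℓ ∈ s, ℓ.Prime ∧ ℓ ≠ 2 := fun ℓ hℓ ↦ hS ℓ (mem_insert_of_mem hℓ)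
    have ha := hS a (mem_insert_self a s)
    have hlam' : ∀ ℓ ∈ s, Function.Periodic (lam ℓ) ℓ := fun ℓ hℓ ↦ hlam ℓ (mem_insert_of_mem hℓ)
    have hP0 : (8 * ∏ ℓ ∈ s, ℓ) ≠ 0 :=
      mul_ne_zero (by norm_num) (prod_ne_zero_iff.mpr fun ℓ hℓ ↦ (hS' ℓ hℓ).1.ne_zero)
    -- periodicity of the partial product
    have hper : Function.Periodic (fun j ↦ u j * ∏ ℓ ∈ s, lam ℓ j) (8 * ∏ ℓ ∈ s, ℓ) := by
      have h1 : Function.Periodic u (8 * ∏ ℓ ∈ s, ℓ) := periodic_of_dvd hu (dvd_mul_right 8 _)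
      have h2 : Function.Periodic (∏ ℓ ∈ s, lam ℓ) (8 * ∏ ℓ ∈ s, ℓ) :=
        s.periodic_prod fun ℓ hℓ ↦ periodic_of_dvd (hlam' ℓ hℓ)
          (dvd_mul_of_dvd_right (dvd_prod_of_mem _ hℓ) 8)
      intro j
      have h2j := h2 j
      simp only [Finset.prod_apply] at h2j
      simp only [h1 j, h2j]
    -- coprimality
    have hcop : (8 * ∏ ℓ ∈ s, ℓ).Coprime a := by
      refine Nat.Coprime.mul_left ?_ ?_
      · have h2 : Nat.Coprime 2 a := (Nat.coprime_primes Nat.prime_two ha.1).mpr ha.2.symm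
        simpa using h2.pow_left 3
      · exact Nat.Coprime.prod_left fun ℓ hℓ ↦
          (Nat.coprime_primes (hS' ℓ hℓ).1 ha.1).mpr fun h ↦ has (h ▸ hℓ)
    simp_rw [prod_insert has]
    rw [show 8 * (a * ∏ ℓ ∈ s, ℓ) = (8 * ∏ ℓ ∈ s, ℓ) * a by ring]
    rw [Finset.sum_congr rfl (fun j _ ↦ show u j * (lam a j * ∏ ℓ ∈ s, lam ℓ j) =
        (u j * ∏ ℓ ∈ s, lam ℓ j) * lam a j by ring)]
    rw [sum_range_mul_eq_of_coprime hcop hP0 ha.1.ne_zero hper (hlam a (mem_insert_self a s)), ih hS' hlam']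
    ring

/-! ### §2. Local means of Legendre symbols -/

/-- `Σ_{j : ZMod Q} f(j) = Σ_{j < Q} f(j)` (`Q ≥ 1`; `ZMod Q = Fin Q`), additive-monoid valued. [folklore] -/
theorem sum_univ_zmod_eq_sum_range {M : Type*} [AddCommMonoid M] {Q : ℕ} [NeZero Q] (f : ℕ → M) :
    ∑ j : ZMod Q, f j.val = ∑ j ∈ range Q, f j := by
  obtain ⟨k, hk⟩ := Nat.exists_eq_succ_of_ne_zero (NeZero.ne Q)
  subst hk
  exact Fin.sum_univ_eq_sum_range f (k + 1)

/-- **`Σ_{j < ℓ} (j/ℓ) = 0`** for an odd prime `ℓ` (the Legendre symbol is a non-trivial character; Mathlib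
`quadraticChar_sum_zero`). [folklore] -/
theorem sum_range_jacobiSym_eq_zero {ℓ : ℕ} (hℓ : ℓ.Prime) (hℓ2 : ℓ ≠ 2) :
    ∑ j ∈ range ℓ, (J((j : ℕ) | ℓ) : ℂ) = 0 := by
  haveI : Fact ℓ.Prime := ⟨hℓ⟩
  have hch : ringChar (ZMod ℓ) ≠ 2 := by rwa [ZMod.ringChar_zmod_n]
  have h := quadraticChar_sum_zero hch
  have h2 : ∑ j ∈ range ℓ, (J((j : ℕ) | ℓ) : ℂ) = ∑ a : ZMod ℓ, ((quadraticChar (ZMod ℓ) a : ℤ) : ℂ) := by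
    rw [← sum_univ_zmod_eq_sum_range (fun j ↦ (J((j : ℕ) | ℓ) : ℂ))]
    refine Finset.sum_congr rfl fun a _ ↦ ?_
    rw [← jacobiSym.legendreSym.to_jacobiSym, legendreSym, Int.cast_natCast, ZMod.natCast_zmod_val]
  rw [h2, ← Int.cast_sum, h, Int.cast_zero]

/-- **`Σ_{j < ℓ} (j/ℓ)² = ℓ − 1`** for a prime `ℓ` (`(j/ℓ)² = 1` for `0 < j < ℓ`, `= 0` at `j = 0`). [folklore] -/
theorem sum_range_jacobiSym_sq {ℓ : ℕ} (hℓ : ℓ.Prime) :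
    ∑ j ∈ range ℓ, (J((j : ℕ) | ℓ) : ℂ) ^ 2 = (ℓ : ℂ) - 1 := by
  obtain ⟨l, hl⟩ := Nat.exists_eq_succ_of_ne_zero hℓ.ne_zero
  subst hl
  rw [Finset.sum_range_succ', Nat.cast_zero, jacobiSym.zero_left hℓ.one_lt]
  have h1 : ∀ j ∈ range l, (J(((j + 1 : ℕ) : ℕ) | l + 1) : ℂ) ^ 2 = 1 := by
    intro j hj
    simp only [mem_range] at hj
    have hcop : Int.gcd ((j + 1 : ℕ) : ℤ) ((l + 1 : ℕ) : ℤ) = 1 := by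
      rw [Int.gcd_natCast_natCast]
      have : Nat.Coprime (l + 1) (j + 1) :=
        (Nat.Prime.coprime_iff_not_dvd hℓ).mpr fun h ↦ by
          have := Nat.le_of_dvd (Nat.succ_pos j) h
          omega
      exact this.symm
    have := jacobiSym.sq_one hcop
    exact_mod_cast this
  rw [Finset.sum_congr rfl h1]
  simp

/-- `(j/ℓ)^v` is `(j/ℓ)²` for even `v ≥ 1` and `(j/ℓ)` for odd `v` (values in `{0, ±1}`). [folklore] -/
theorem jacobiSym_pow_eq (a : ℤ) (b : ℕ) {v : ℕ} (hv : v ≠ 0) :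
    (J(a | b) : ℂ) ^ v = if Even v then (J(a | b) : ℂ) ^ 2 else (J(a | b) : ℂ) := by
  rcases jacobiSym.trichotomy a b with h | h | h <;> rw [h]
  · simp [zero_pow hv]
  · simp
  · push_cast
    split_ifs with he
    · rw [he.neg_one_pow]; norm_num
    · rw [(Nat.not_even_iff_odd.mp he).neg_one_pow]

/-- **`Σ_{j < ℓ} (j/ℓ)^v = [v even]·(ℓ − 1)`** for an odd prime `ℓ` and `v ≥ 1`. [folklore] -/
theorem sum_range_jacobiSym_pow {ℓ : ℕ} (hℓ : ℓ.Prime) (hℓ2 : ℓ ≠ 2) {v : ℕ} (hv : v ≠ 0) :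
    ∑ j ∈ range ℓ, (J((j : ℕ) | ℓ) : ℂ) ^ v = if Even v then (ℓ : ℂ) - 1 else 0 := by
  simp_rw [jacobiSym_pow_eq _ _ hv]
  split_ifs
  · exact sum_range_jacobiSym_sq hℓ
  · exact sum_range_jacobiSym_eq_zero hℓ hℓ2

/-- The indicator of `(a/b) = +1` is `((a/b)² + (a/b))/2` (values in `{0, ±1}`). [folklore] -/
theorem ite_jacobiSym_eq_one (a : ℤ) (b : ℕ) :
    (if J(a | b) = 1 then (1 : ℂ) else 0) = ((J(a | b) : ℂ) ^ 2 + J(a | b)) / 2 := by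
  rcases jacobiSym.trichotomy a b with h | h | h <;> rw [h] <;> norm_num

/-- **`#{j < q : (−j/q) = +1} = (q − 1)/2`** for an odd prime `q` (half of the non-zero residues `−j` are squares),
as a complex number. [folklore] -/
theorem sum_range_ite_jacobiSym_neg_eq {q : ℕ} (hq : q.Prime) (hq2 : q ≠ 2) :
    ∑ j ∈ range q, (if J(-((j : ℕ) : ℤ) | q) = 1 then (1 : ℂ) else 0) = ((q : ℂ) - 1) / 2 := by
  have hodd : Odd q := hq.odd_of_ne_two hq2
  simp_rw [ite_jacobiSym_eq_one, jacobiSym.neg _ hodd]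
  push_cast
  have hχ : ((ZMod.χ₄ q : ℤ) : ℂ) ^ 2 = 1 := by
    rcases ZMod.χ₄_nat_eq_if_mod_four q with h
    rw [h]
    have hq2' : q % 2 = 1 := Nat.odd_iff.mp hodd
    split_ifs with h0 h1
    · omega
    · norm_num
    · norm_num
  rw [← Finset.sum_div, Finset.sum_add_distrib]
  simp_rw [mul_pow, hχ, one_mul, ← Finset.mul_sum]
  rw [sum_range_jacobiSym_sq hq, sum_range_jacobiSym_eq_zero hq hq2, mul_zero, add_zero]

/-! ### §3. The two small blocks of the cusp-seed family (moduli `8` and `3`) -/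

/-- **The block at `2`** of the cusp-seed family: on `N ≡ 3 (mod 4)` (and `N ≡ 7 (mod 8)` in the case «`2 ∣ m`») weighted by
`(2/N)^v`: `Σ_{j<8} = 1` in the case `2 ∣ m`, and `= 1 + (−1)^v` otherwise (`(2/3) = −1`, `(2/7) = +1`). [folklore] -/
theorem sum_range_eight_block (c : Prop) [Decidable c] (v : ℕ) :
    ∑ j ∈ range 8, (if j % 4 = 3 ∧ (c → j % 8 = 7) then (J(2 | j) : ℂ) ^ v else 0) =
      if c then 1 else 1 + (-1 : ℂ) ^ v := by
  have h3 : J(2 | 3) = -1 := by norm_num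
  have h7 : J(2 | 7) = 1 := by norm_num
  by_cases hc : c
  · simp [Finset.sum_range_succ, hc, h7]
  · simp [Finset.sum_range_succ, hc, h3, h7]
    ring

/-- **The block at `3`** of the cusp-seed family: on `3 ∤ N` (and `(−N/3) = +1`, i.e. `N ≡ 2 (mod 3)`, in the case «`3 ∣ m`»)
weighted by `(N/3)^v`: `Σ_{j<3} = (−1)^v` in the case `3 ∣ m`, and `= 1 + (−1)^v` otherwise. [folklore] -/
theorem sum_range_three_block (c : Prop) [Decidable c] (v : ℕ) :
    ∑ j ∈ range 3, (if ¬ 3 ∣ j ∧ (c → J(-((j : ℕ) : ℤ) | 3) = 1) then (J((j : ℕ) | 3) : ℂ) ^ v else 0) =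
      if c then (-1 : ℂ) ^ v else 1 + (-1 : ℂ) ^ v := by
  have h1 : J(1 | 3) = 1 := by norm_num
  have h2 : J(2 | 3) = -1 := by norm_num
  have hn1 : J(-1 | 3) = -1 := by norm_num
  have hn2 : J(-2 | 3) = 1 := by norm_num
  by_cases hc : c
  · simp [Finset.sum_range_succ, hc, h2, hn1, hn2]
  · simp [Finset.sum_range_succ, hc, h1, h2]

end Summit.BirchSwinnertonDyer.BirchSwinnertonDyer.Theorems.PrintCFram.FamilyMean
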